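import Mathlib.Analysis.SpecialFunctions.Pow.Real
import Mathlib.Analysis.SpecialFunctions.Sqrt
import HarnessLib

/-!
# Monotonicity of the LHY summand in the coupling:
# `g ↦ √(r⁴ + 2gr²) - r² - g + g²/(2r²)` is non-decreasing on `[0, ∞)` for `r > 0`

Topic `Literature/MathematicalPhysics/QuantumManyBody`; a one-lemma companion of
`DiluteBoseGasLHYRiemannSum.lean` for the provefact
`Literature.MathematicalPhysics.QuantumManyBody.BoseGas.BastiCenatiempoSchlein2021_upperBound`.
In [BastiCenatiempoSchlein2021, p. 13, (const5)] the second-order term is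
`½∑_v F_{8π𝔞N^κ}(v)`, `F_g(v) = √(v⁴ + 2g v²) - v² - g + g²/(2v²)`, with the coupling `g = 8π𝔞N^κ`
identified through `|ĝ_0 - 8π𝔞N^κ| ≤ CN^{2κ-1}` (Vastf). When the correlation data are produced
variationally (Galerkin kernel, `TorusGalerkinScattering.lean`) one only knows an *upper* bound
`g₀ ≤ 8π𝔞N^κ(1+δ)` for the effective coupling; the present monotonicity (together with that of the
leading term `(N/2)g`) transfers the energy bound from `g₀` to `8π𝔞N^κ(1+δ)`.

* `lhySummand_mono`: for `r > 0` and `0 ≤ g ≤ g'`, `F_g(r) ≤ F_{g'}(r)`; proof: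
  `F_{g'} - F_g = (g'-g)[2r²/(s+s') - 1 + (g+g')/(2r²)]` with `s = √(r⁴+2gr²) ≤ r² + g`, and
  `r²/(r²+m) + m/r² - 1 = m²/(r²(r²+m)) ≥ 0`, `m = (g+g')/2`.

## References

* [BastiCenatiempoSchlein2021] G. Basti, S. Cenatiempo, B. Schlein, Forum Math. Sigma 9 (2021) e74,
  arXiv:2101.06222: p. 13, (const5) and the display before it (`F`).
-/

noncomputable section

namespace Literature.MathematicalPhysics.QuantumManyBody.BoseGas

/-- `√(r⁴ + 2gr²) ≤ r² + g` for `g ≥ 0`. [folklore] -/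
theorem sqrt_quartic_le {r g : ℝ} (hg : 0 ≤ g) : Real.sqrt (r ^ 4 + 2 * g * r ^ 2) ≤ r ^ 2 + g := by
  refine Real.sqrt_le_iff.2 ⟨by positivity, ?_⟩
  nlinarith [sq_nonneg g]

/-- **The LHY summand is non-decreasing in the coupling**: for `r > 0` and `0 ≤ g ≤ g'`,
`√(r⁴+2gr²) - r² - g + g²/(2r²) ≤ √(r⁴+2g'r²) - r² - g' + g'²/(2r²)`.
[cite: BastiCenatiempoSchlein2021, p. 13 (const5), `F(v)`] -/
theorem lhySummand_mono {r g g' : ℝ} (hr : 0 < r) (hg : 0 ≤ g) (hgg' : g ≤ g') :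
    Real.sqrt (r ^ 4 + 2 * g * r ^ 2) - r ^ 2 - g + g ^ 2 / (2 * r ^ 2) ≤
      Real.sqrt (r ^ 4 + 2 * g' * r ^ 2) - r ^ 2 - g' + g' ^ 2 / (2 * r ^ 2) := by
  have hg' : 0 ≤ g' := hg.trans hgg'
  set s := Real.sqrt (r ^ 4 + 2 * g * r ^ 2) with hs
  set s' := Real.sqrt (r ^ 4 + 2 * g' * r ^ 2) with hs'
  have hr2 : 0 < r ^ 2 := by positivity
  have hs0 : 0 ≤ s := Real.sqrt_nonneg _
  have hs'0 : 0 ≤ s' := Real.sqrt_nonneg _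
  have hsr : r ^ 2 ≤ s := by
    rw [hs]; refine Real.le_sqrt_of_sq_le ?_  -- name may differ
    nlinarith
  have hs'r : r ^ 2 ≤ s' := by
    rw [hs']; refine Real.le_sqrt_of_sq_le ?_
    nlinarith
  have hsle : s ≤ r ^ 2 + g := sqrt_quartic_le hg
  have hs'le : s' ≤ r ^ 2 + g' := sqrt_quartic_le hg'
  -- `s' - s = 2r²(g'-g)/(s+s')`
  have hss : 0 < s + s' := by nlinarith
  have hdiff : s' - s = 2 * r ^ 2 * (g' - g) / (s + s') := by
    have hsq : s ^ 2 = r ^ 4 + 2 * g * r ^ 2 := by rw [hs]; exact Real.sq_sqrt (by positivity)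
    have hsq' : s' ^ 2 = r ^ 4 + 2 * g' * r ^ 2 := by rw [hs']; exact Real.sq_sqrt (by positivity)
    field_simp
    nlinarith
  -- reduce to the bracket inequality
  suffices h : 0 ≤ (g' - g) * (2 * r ^ 2 / (s + s') - 1 + (g + g') / (2 * r ^ 2)) by
    have : Real.sqrt (r ^ 4 + 2 * g' * r ^ 2) - r ^ 2 - g' + g' ^ 2 / (2 * r ^ 2) -
        (Real.sqrt (r ^ 4 + 2 * g * r ^ 2) - r ^ 2 - g + g ^ 2 / (2 * r ^ 2)) =
        (g' - g) * (2 * r ^ 2 / (s + s') - 1 + (g + g') / (2 * r ^ 2)) := by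
      rw [← hs, ← hs']
      have h1 : s' - r ^ 2 - g' + g' ^ 2 / (2 * r ^ 2) - (s - r ^ 2 - g + g ^ 2 / (2 * r ^ 2)) =
          (s' - s) - (g' - g) + (g' ^ 2 - g ^ 2) / (2 * r ^ 2) := by ring
      rw [h1, hdiff]
      field_simp
      ring
    linarith
  refine mul_nonneg (by linarith) ?_
  -- `2r²/(s+s') ≥ 2r²/(2r²+g+g') = r²/(r²+m)` and `r²/(r²+m) + m/r² ≥ 1`
  set m := (g + g') / 2 with hm
  have hm0 : 0 ≤ m := by positivity
  have h1 : r ^ 2 / (r ^ 2 + m) ≤ 2 * r ^ 2 / (s + s') := by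
    rw [div_le_div_iff₀ (by positivity) hss]
    nlinarith
  have h2 : 1 ≤ r ^ 2 / (r ^ 2 + m) + m / r ^ 2 := by
    rw [div_add_div _ _ (by positivity) hr2.ne', le_div_iff₀ (by positivity)]
    nlinarith [sq_nonneg m]
  have h3 : (g + g') / (2 * r ^ 2) = m / r ^ 2 := by rw [hm]; field_simp
  rw [h3]
  linarith

/-- The `𝔞`-form: with `g = 8π𝔞`, the summand
`√(r⁴ + 16π𝔞r²) - r² - 8π𝔞 + (8π𝔞)²/(2r²)` of `BastiCenatiempoSchlein2021_lhyRiemannSum` is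
non-decreasing in `𝔞 ≥ 0` (for `r > 0`). [cite: BastiCenatiempoSchlein2021, p. 13 (const5)] -/
theorem lhySummand_mono_scatteringLength {r 𝔞 𝔞' : ℝ} (hr : 0 < r) (h𝔞 : 0 ≤ 𝔞) (h𝔞𝔞' : 𝔞 ≤ 𝔞') :
    Real.sqrt (r ^ 4 + 16 * Real.pi * 𝔞 * r ^ 2) - r ^ 2 - 8 * Real.pi * 𝔞 + (8 * Real.pi * 𝔞) ^ 2 / (2 * r ^ 2) ≤
      Real.sqrt (r ^ 4 + 16 * Real.pi * 𝔞' * r ^ 2) - r ^ 2 - 8 * Real.pi * 𝔞' +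
        (8 * Real.pi * 𝔞') ^ 2 / (2 * r ^ 2) := by
  have h := lhySummand_mono (g := 8 * Real.pi * 𝔞) (g' := 8 * Real.pi * 𝔞') hr (by positivity)
    (by nlinarith [Real.pi_pos])
  have e1 : 2 * (8 * Real.pi * 𝔞) * r ^ 2 = 16 * Real.pi * 𝔞 * r ^ 2 := by ring
  have e2 : 2 * (8 * Real.pi * 𝔞') * r ^ 2 = 16 * Real.pi * 𝔞' * r ^ 2 := by ring
  rw [e1, e2] at h
  exact h

end Literature.MathematicalPhysics.QuantumManyBody.BoseGas

end
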